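import Literature.MathematicalPhysics.QuantumLattice.YangMillsSphereGapSmallGauge
import Literature.Analysis.Calculus.SphereIntegralCalculus
import HarnessLib

/-!
# Radial derivatives of the sphere energy `q(r) = ∮_{S_r} ∑ₐ ‖u_a‖²` of the Hodge-dual field

QuantumLattice support file (everything proved; no definitions, no named facts) on the proof
path of `Literature.MathematicalPhysics.QuantumLattice.Waldron2019_yangMillsFlow_flatTorus`
(A. Waldron, Invent. math. 217 (2019)), §4 (`f₁² = r² q`, the `f₁`-chain in the
`u = ⋆(x ∧ F)` formalism). For a `𝔲(N)`-valued `C³` connection `A` on `ℝ⁴`,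
`u_a = hodgeSec e A a`, `p = ∑ₐ ‖u_a‖²` and `r > 0`:

* `fderiv_sphereEnergyDensity` — `∂ᵥ p = 2∑ₐ ⟨u_a, D_v u_a⟩` (metric compatibility);
* `hasDerivAt_sphereEnergy` — `q'(r) = r⁻¹ ∮_{S_r} ∂ₓ p` with `∂ₓ p(x) = Dp(x)(x)`, i.e.
  `r q' = 2 ∮ ∑ₐ⟨u_a, D_x u_a⟩`;
* `fderiv_radial_radial_sphereEnergyDensity` — `D(y ↦ Dp(y)(x))(x)(x) = 2∑ₐ(‖D_x u_a‖² + ⟨u_a, D_x(D_x u_a)⟩)`;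
* `hasDerivAt_sphereEnergy_deriv` — the derivative of `ρ ↦ ρ⁻¹ ∮_{S_ρ} ∂ₓ p` at `r` is
  `r⁻² ∮_{S_r} 2∑ₐ(‖D_x u_a‖² + ⟨u_a, D_x(D_x u_a)⟩)`, i.e.
  `r² q'' = 2 ∮ ∑ₐ ‖D_x u_a‖² + 2 ∮ ∑ₐ ⟨u_a, D_xD_x u_a⟩`.

References: A. Waldron, Invent. math. 217 (2019), §4.2 ((4.8)–(4.10)) [Waldron2019]; J. Råde,
J. reine angew. Math. 431 (1992) [folklore].
-/

noncomputable section

open scoped RealInnerProductSpace Matrix.Norms.Frobenius Topology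
open Set MeasureTheory Metric Filter
open Literature.Analysis.FluidPDE Literature.Analysis.Calculus Literature.Analysis.InnerProduct

namespace Literature.MathematicalPhysics.QuantumLattice

attribute [local instance] frobeniusInnerProductSpace

variable {N : ℕ}

local notation "𝔼" => EuclideanSpace ℝ (Fin 4)
local notation "𝕓" => EuclideanSpace.basisFun (Fin 4) ℝ
local notation "𝔤" => Matrix (Fin N) (Fin N) ℂ

/-! ### The energy density and its first derivative -/

/-- **`∂ᵥ ∑ₐ ‖u_a‖² = 2 ∑ₐ ⟨u_a, D_v u_a⟩`** for a skew-valued connection. [folklore] -/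
theorem fderiv_sphereEnergyDensity {A : Connection 𝔼 𝔤} (hA : ContDiff ℝ 3 A)
    (hval : A.IsValuedIn (skewAdjoint.submodule ℝ 𝔤)) (x v : 𝔼) :
    fderiv ℝ (fun y => ∑ a, ‖hodgeSec 𝕓 A a y‖ ^ 2) x v =
      2 * ∑ a, ⟪hodgeSec 𝕓 A a x, covDeriv A (hodgeSec 𝕓 A a) x v⟫ := by
  have hu : ∀ a, Differentiable ℝ (hodgeSec 𝕓 A a) := fun a =>
    (contDiff_hodgeSec hA a).differentiable two_ne_zero
  rw [fderiv_fun_sum fun a _ => ((hu a) x).norm_sq ℝ]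
  simp only [FunLike.coe_sum, Finset.sum_apply, Finset.mul_sum]
  refine Finset.sum_congr rfl fun a _ => ?_
  exact fderiv_norm_sq_eq_two_inner_covDeriv ((hu a) x) v (hval x v)

/-- `p = ∑ₐ ‖u_a‖²` is `C²` for `A ∈ C³`. [folklore] -/
theorem contDiff_sphereEnergyDensity {A : Connection 𝔼 𝔤} (hA : ContDiff ℝ 3 A) :
    ContDiff ℝ 2 fun y : 𝔼 => ∑ a, ‖hodgeSec 𝕓 A a y‖ ^ 2 :=
  ContDiff.sum fun a _ => (contDiff_hodgeSec hA a).norm_sq ℝ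

/-- **First radial derivative of the sphere energy**: `q'(r) = r⁻¹ ∮_{S_r} Dp(x)(x)`. [folklore] -/
theorem hasDerivAt_sphereEnergy {A : Connection 𝔼 𝔤} (hA : ContDiff ℝ 3 A) {r : ℝ} (hr : 0 < r) :
    HasDerivAt (sphereIntegral (volume : Measure 𝔼) (fun y => ∑ a, ‖hodgeSec 𝕓 A a y‖ ^ 2))
      (r⁻¹ * sphereIntegral (volume : Measure 𝔼)
        (fun x => fderiv ℝ (fun y => ∑ a, ‖hodgeSec 𝕓 A a y‖ ^ 2) x x) r) r := by
  haveI : Nontrivial 𝔼 := inferInstance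
  have hp := contDiff_sphereEnergyDensity hA
  have h := hasDerivAt_sphereIntegral_radial_of_contDiffOn ((hp.of_le (by norm_num)).contDiffOn) hr
  refine h.congr_deriv ?_
  rw [← sphereIntegral_mul_left]
  refine sphereIntegral_congr_norm hr.le fun x hx => ?_
  rw [map_smul, smul_eq_mul, hx]

/-- The derivative function of `q` on `(0, ∞)`. [folklore] -/
theorem deriv_sphereEnergy {A : Connection 𝔼 𝔤} (hA : ContDiff ℝ 3 A) {ρ : ℝ} (hρ : 0 < ρ) :
    deriv (sphereIntegral (volume : Measure 𝔼) (fun y => ∑ a, ‖hodgeSec 𝕓 A a y‖ ^ 2)) ρ =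
      ρ⁻¹ * sphereIntegral (volume : Measure 𝔼)
        (fun x => fderiv ℝ (fun y => ∑ a, ‖hodgeSec 𝕓 A a y‖ ^ 2) x x) ρ :=
  (hasDerivAt_sphereEnergy hA hρ).deriv

/-! ### The second radial derivative -/

/-- **`D(y ↦ Dp(y)(x))(x)(x) = 2∑ₐ(‖D_x u_a‖² + ⟨u_a, D_x(D_x u_a)⟩)`** (frozen radial direction).
[folklore] -/
theorem fderiv_radial_radial_sphereEnergyDensity {A : Connection 𝔼 𝔤} (hA : ContDiff ℝ 3 A)
    (hval : A.IsValuedIn (skewAdjoint.submodule ℝ 𝔤)) (x : 𝔼) :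
    fderiv ℝ (fun y => fderiv ℝ (fun z => ∑ a, ‖hodgeSec 𝕓 A a z‖ ^ 2) y x) x x =
      2 * ∑ a, (‖covDeriv A (hodgeSec 𝕓 A a) x x‖ ^ 2 +
        ⟪hodgeSec 𝕓 A a x, covDeriv A (fun y => covDeriv A (hodgeSec 𝕓 A a) y x) x x⟫) := by
  have hA1 : ContDiff ℝ 1 A := hA.of_le (by norm_num)
  have hu2 : ∀ a, ContDiff ℝ 2 (hodgeSec 𝕓 A a) := fun a => contDiff_hodgeSec hA a
  have hud : ∀ a, Differentiable ℝ (hodgeSec 𝕓 A a) := fun a => (hu2 a).differentiable two_ne_zero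
  -- `y ↦ D_x u_a(y)` (frozen direction) is differentiable
  have hDu : ∀ a, Differentiable ℝ (fun y => covDeriv A (hodgeSec 𝕓 A a) y x) := by
    intro a
    have h : ContDiff ℝ 1 (fun y => covDeriv A (hodgeSec 𝕓 A a) y x) :=
      contDiff_covDeriv_apply hA1 (by rw [show ((1 : WithTop ℕ∞) + 1) = 2 by norm_num]; exact hu2 a) x
    exact h.differentiable (by simp)
  -- rewrite the inner function
  have hfun : (fun y => fderiv ℝ (fun z => ∑ a, ‖hodgeSec 𝕓 A a z‖ ^ 2) y x) =
      fun y => 2 * ∑ a, ⟪hodgeSec 𝕓 A a y, covDeriv A (hodgeSec 𝕓 A a) y x⟫ :=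
    funext fun y => fderiv_sphereEnergyDensity hA hval y x
  rw [hfun]
  have hterm : ∀ a, DifferentiableAt ℝ (fun y => ⟪hodgeSec 𝕓 A a y, covDeriv A (hodgeSec 𝕓 A a) y x⟫) x :=
    fun a => ((hud a) x).inner ℝ ((hDu a) x)
  have hsum : DifferentiableAt ℝ (fun y => ∑ a, ⟪hodgeSec 𝕓 A a y, covDeriv A (hodgeSec 𝕓 A a) y x⟫) x := by
    have := DifferentiableAt.fun_sum (u := Finset.univ) fun a _ => hterm a
    simpa using this
  rw [fderiv_const_mul hsum]
  simp only [FunLike.coe_smul, Pi.smul_apply, smul_eq_mul]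
  congr 1
  rw [fderiv_fun_sum fun a _ => hterm a]
  simp only [FunLike.coe_sum, Finset.sum_apply]
  refine Finset.sum_congr rfl fun a _ => ?_
  rw [fderiv_frobenius_inner_eq_covDeriv ((hud a) x) ((hDu a) x) x (hval x x), real_inner_self_eq_norm_sq]

/-- `h(y) = Dp(y)(y)` is `C¹`, and `Dh(x)(x) = D(y ↦ Dp(y)(x))(x)(x) + Dp(x)(x)`. [folklore] -/
theorem contDiff_radialDeriv_sphereEnergyDensity {A : Connection 𝔼 𝔤} (hA : ContDiff ℝ 3 A) :
    ContDiff ℝ 1 fun y : 𝔼 => fderiv ℝ (fun z => ∑ a, ‖hodgeSec 𝕓 A a z‖ ^ 2) y y :=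
  ((contDiff_sphereEnergyDensity hA).fderiv_right (m := 1) le_rfl).clm_apply contDiff_id

/-- Auxiliary: `Dh(x)(x) = D(y ↦ Dp(y)(x))(x)(x) + Dp(x)(x)`. [folklore] -/
theorem fderiv_radialDeriv_sphereEnergyDensity {A : Connection 𝔼 𝔤} (hA : ContDiff ℝ 3 A) (x : 𝔼) :
    fderiv ℝ (fun y : 𝔼 => fderiv ℝ (fun z => ∑ a, ‖hodgeSec 𝕓 A a z‖ ^ 2) y y) x x =
      fderiv ℝ (fun y => fderiv ℝ (fun z => ∑ a, ‖hodgeSec 𝕓 A a z‖ ^ 2) y x) x x +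
        fderiv ℝ (fun z => ∑ a, ‖hodgeSec 𝕓 A a z‖ ^ 2) x x := by
  set p : 𝔼 → ℝ := fun z => ∑ a, ‖hodgeSec 𝕓 A a z‖ ^ 2 with hp_def
  have hp := contDiff_sphereEnergyDensity hA
  have hDp : DifferentiableAt ℝ (fderiv ℝ p) x :=
    ((hp.fderiv_right (m := 1) le_rfl).differentiable (by simp)) x
  rw [fderiv_clm_apply (u := fun y => y) hDp differentiableAt_fun_id,
    fderiv_clm_apply (u := fun _ => x) hDp (differentiableAt_const x)]
  simp only [FunLike.coe_add, Pi.add_apply, ContinuousLinearMap.comp_apply, fderiv_fun_id,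
    ContinuousLinearMap.id_apply, ContinuousLinearMap.flip_apply, fderiv_fun_const, Pi.zero_apply,
    ContinuousLinearMap.comp_zero, zero_add]
  rw [add_comm]

/-- **Second radial derivative of the sphere energy**: the derivative of
`ρ ↦ ρ⁻¹ ∮_{S_ρ} Dp(x)(x)` (`= q'`) at `r` is `r⁻² ∮_{S_r} 2∑ₐ(‖D_x u_a‖² + ⟨u_a, D_x(D_x u_a)⟩)`.
[folklore] -/
theorem hasDerivAt_sphereEnergy_deriv {A : Connection 𝔼 𝔤} (hA : ContDiff ℝ 3 A)
    (hval : A.IsValuedIn (skewAdjoint.submodule ℝ 𝔤)) {r : ℝ} (hr : 0 < r) :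
    HasDerivAt (fun ρ => ρ⁻¹ * sphereIntegral (volume : Measure 𝔼)
        (fun x => fderiv ℝ (fun y => ∑ a, ‖hodgeSec 𝕓 A a y‖ ^ 2) x x) ρ)
      (r⁻¹ ^ 2 * sphereIntegral (volume : Measure 𝔼)
        (fun x => 2 * ∑ a, (‖covDeriv A (hodgeSec 𝕓 A a) x x‖ ^ 2 +
          ⟪hodgeSec 𝕓 A a x, covDeriv A (fun y => covDeriv A (hodgeSec 𝕓 A a) y x) x x⟫)) r) r := by
  haveI : Nontrivial 𝔼 := inferInstance
  set p : 𝔼 → ℝ := fun z => ∑ a, ‖hodgeSec 𝕓 A a z‖ ^ 2 with hp_def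
  set h : 𝔼 → ℝ := fun y => fderiv ℝ p y y with hh_def
  have hh1 : ContDiff ℝ 1 h := contDiff_radialDeriv_sphereEnergyDensity hA
  have hp := contDiff_sphereEnergyDensity hA
  -- derivative of `∮ h`
  have hI := hasDerivAt_sphereIntegral_radial_of_contDiffOn hh1.contDiffOn hr
  -- rewrite its value: `∮ Dh(x)(x/‖x‖) = r⁻¹ (∮ D²p(x)(x,x) + ∮ h)`
  set S2 : 𝔼 → ℝ := fun x => 2 * ∑ a, (‖covDeriv A (hodgeSec 𝕓 A a) x x‖ ^ 2 +
    ⟪hodgeSec 𝕓 A a x, covDeriv A (fun y => covDeriv A (hodgeSec 𝕓 A a) y x) x x⟫) with hS2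
  have hS2eq : ∀ x, fderiv ℝ (fun y => fderiv ℝ p y x) x x = S2 x := fun x =>
    fderiv_radial_radial_sphereEnergyDensity hA hval x
  have hhc : ContinuousOn h {0}ᶜ := hh1.continuous.continuousOn
  have hS2c : Continuous S2 := by
    -- `S2 = Dh(·)(·) − h`, a difference of continuous functions
    have h1 : Continuous fun x : 𝔼 => fderiv ℝ h x x := (hh1.continuous_fderiv one_ne_zero).clm_apply continuous_id
    have heq : S2 = fun x => fderiv ℝ h x x - h x := by
      funext x; rw [← hS2eq x, hh_def, fderiv_radialDeriv_sphereEnergyDensity hA x]; ring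
    rw [heq]; exact h1.sub hh1.continuous
  have hval_I : sphereIntegral (volume : Measure 𝔼) (fun x => fderiv ℝ h x (‖x‖⁻¹ • x)) r =
      r⁻¹ * (sphereIntegral (volume : Measure 𝔼) S2 r + sphereIntegral (volume : Measure 𝔼) h r) := by
    rw [← sphereIntegral_add_of S2 h hS2c.continuousOn hhc hr, ← sphereIntegral_mul_left]
    refine sphereIntegral_congr_norm hr.le fun x hx => ?_
    rw [map_smul, smul_eq_mul, hx, hh_def, fderiv_radialDeriv_sphereEnergyDensity hA x, hS2eq x]
  rw [hval_I] at hI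
  -- product rule for `ρ⁻¹ · ∮ h`
  have hinv : HasDerivAt (fun ρ : ℝ => ρ⁻¹) (-(r ^ 2)⁻¹) r := by
    simpa using hasDerivAt_inv hr.ne'
  have h := hinv.mul hI
  refine h.congr_deriv ?_
  field_simp
  ring

end Literature.MathematicalPhysics.QuantumLattice
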